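import Summits.MatrixMultiplication.MatrixMultiplication.Theorems.AbelianSTPPCensusTECertSearch

/-!
# Certificate checker for `ShapeExclusionTE`: coverage by chunks and the coordinate symmetry (O1)

Cell mm-stpp, route `AbelianSTPPCensus`, crux `ShapeExclusionTE` (stmt-MatrixMultiplication-19759); see the module docstring of
`AbelianSTPPCensusTECertDefs.lean` for the design of the certificate checker.  Support file (no new definitions).

Content: `Covered M` from accepted `teCheck` chunks / `teBatch` batches; invariance of `AdmM` and of the value sum
under the two generating transpositions of the coordinates (applied to all members), closedness of the residual lists,
and the sorting of the maximal member (a three-step compare–swap): `residual_of_adm` — at a covered order `M ≤ 127`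
every family with `AdmM M` and value sum `> K·M` contains a registered residual.
-/

-- single-conjunct summit: the mandated namespace repeats `MatrixMultiplication`.
set_option linter.dupNamespace false

namespace Summit.MatrixMultiplication.MatrixMultiplication.Theorems.TECert

/-! ## Coverage of an order by evaluated chunks -/

/-- Coverage of one order from accepted `teCheck` chunks. -/
theorem covered_of_teCheck {M : ℕ} (chunks : List (ℕ × ℕ)) (hall : ∀ p ∈ chunks, teCheck M p.1 p.2 = true)
    (hcov : ∀ V₁, 1 ≤ V₁ → V₁ ≤ M → ∃ p ∈ chunks, p.1 ≤ V₁ ∧ V₁ < p.2) : Covered M := by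
  intro V₁ h1 h2
  obtain ⟨p, hp, hlo, hhi⟩ := hcov V₁ h1 h2
  have h := hall p hp
  simp only [teCheck, Bool.and_eq_true] at h
  exact ⟨p.1, p.2, M, hlo, hhi, le_rfl, h.2⟩

/-- Coverage of every order of an accepted batch. -/
theorem covered_of_teBatch {lo k : ℕ} (h : teBatch lo k = true) {M : ℕ} (hlo : lo ≤ M) (hhi : M < lo + k) :
    Covered M := by
  intro V₁ h1 h2
  simp only [teBatch, Bool.and_eq_true, List.all_eq_true, List.mem_range] at h
  have := h.2 (M - lo) (by omega)
  rw [show lo + (M - lo) = M by omega] at this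
  exact ⟨0, lo + k, lo + k, Nat.zero_le _, by omega, by omega, this⟩

/-! ## Coordinate symmetry (the two generating transpositions) -/

section Symmetry

variable {M : ℕ} {F : Multiset (ℕ × ℕ × ℕ)}

/-- the table test, linearised (for positive sizes) -/
theorem tableOK_iff' {M a b c : ℕ} (ha : 1 ≤ a) (hb : 1 ≤ b) (hc : 1 ≤ c) :
    tableOK M a b c = true ↔ a * b * c ≤ M ∧ a * b + c * a ≤ M + a ∧ a * b + b * c ≤ M + b ∧
      b * c + c * a ≤ M + c ∧ a * b * c + a ≤ M ∧ a * b * c + b ≤ M ∧ a * b * c + c ≤ M := by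
  rw [tableOK_iff]
  have e1 : a * (b + c - 1) = a * b + c * a - a := by
    rw [Nat.mul_sub_one, Nat.left_distrib]; ring_nf
  have e2 : b * (c + a - 1) = a * b + b * c - b := by
    rw [Nat.mul_sub_one, Nat.left_distrib]; ring_nf
  have e3 : c * (a + b - 1) = b * c + c * a - c := by
    rw [Nat.mul_sub_one, Nat.left_distrib]; ring_nf
  have l1 : a ≤ a * b := by nlinarith
  have l2 : b ≤ b * c := by nlinarith
  have l3 : c ≤ c * a := by nlinarith
  rw [e1, e2, e3]
  omega

/-- Members of the transposed family (first two coordinates). -/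
theorem mem_map_swap12 {t : ℕ × ℕ × ℕ} (ht : t ∈ F.map fun t => (t.2.1, t.1, t.2.2)) :
    ∃ s ∈ F, t = (s.2.1, s.1, s.2.2) := by
  obtain ⟨s, hs, rfl⟩ := Multiset.mem_map.mp ht; exact ⟨s, hs, rfl⟩

/-- Members of the transposed family (last two coordinates). -/
theorem mem_map_swap23 {t : ℕ × ℕ × ℕ} (ht : t ∈ F.map fun t => (t.1, t.2.2, t.2.1)) :
    ∃ s ∈ F, t = (s.1, s.2.2, s.2.1) := by
  obtain ⟨s, hs, rfl⟩ := Multiset.mem_map.mp ht; exact ⟨s, hs, rfl⟩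

/-- The sums of the transposed family (first two coordinates). -/
theorem sums_swap12 :
    sumP (F.map fun t => (t.2.1, t.1, t.2.2)) = sumP F ∧ sumQ (F.map fun t => (t.2.1, t.1, t.2.2)) = sumR F ∧
      sumR (F.map fun t => (t.2.1, t.1, t.2.2)) = sumQ F ∧ sumVal (F.map fun t => (t.2.1, t.1, t.2.2)) = sumVal F := by
  simp only [sumP, sumQ, sumR, sumVal, Multiset.map_map, Function.comp_def, uu, vv, ww, vol]
  refine ⟨?_, ?_, ?_, ?_⟩ <;> congr 1 <;> refine Multiset.map_congr rfl fun t _ => ?_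
  · exact Nat.mul_comm _ _
  · exact Nat.mul_comm _ _
  · exact Nat.mul_comm _ _
  · rw [Nat.mul_comm t.2.1 t.1]

/-- The sums of the transposed family (last two coordinates). -/
theorem sums_swap23 :
    sumP (F.map fun t => (t.1, t.2.2, t.2.1)) = sumR F ∧ sumQ (F.map fun t => (t.1, t.2.2, t.2.1)) = sumQ F ∧
      sumR (F.map fun t => (t.1, t.2.2, t.2.1)) = sumP F ∧ sumVal (F.map fun t => (t.1, t.2.2, t.2.1)) = sumVal F := by
  simp only [sumP, sumQ, sumR, sumVal, Multiset.map_map, Function.comp_def, uu, vv, ww, vol]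
  refine ⟨?_, ?_, ?_, ?_⟩ <;> congr 1 <;> refine Multiset.map_congr rfl fun t _ => ?_
  · exact Nat.mul_comm _ _
  · exact Nat.mul_comm _ _
  · exact Nat.mul_comm _ _
  · rw [Nat.mul_assoc, Nat.mul_comm t.2.2 t.2.1, ← Nat.mul_assoc]

/-- `AdmM` is invariant under transposing the first two coordinates of every member. -/
theorem adm_swap12 (hA : AdmM M F) : AdmM M (F.map fun t => (t.2.1, t.1, t.2.2)) := by
  obtain ⟨eP, eQ, eR, -⟩ := sums_swap12 (F := F)
  obtain ⟨htab, ⟨hP, hQ, hR⟩, h11, h14⟩ := hA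
  refine ⟨?_, ?_, ?_, ?_⟩
  · intro t ht
    obtain ⟨s, hs, rfl⟩ := mem_map_swap12 ht
    obtain ⟨h1, h2, h3, h4⟩ := htab s hs
    refine ⟨h2, h1, h3, ?_⟩
    rw [tableOK_iff' h1 h2 h3] at h4
    rw [tableOK_iff' h2 h1 h3]
    have c1 : s.2.1 * s.1 * s.2.2 = s.1 * s.2.1 * s.2.2 := by ring
    have c2 : s.2.1 * s.1 = s.1 * s.2.1 := by ring
    have c3 : s.2.2 * s.2.1 = s.2.1 * s.2.2 := by ring
    have c4 : s.1 * s.2.2 = s.2.2 * s.1 := by ring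
    rw [c1, c2, c3, c4]
    omega
  · rw [eP, eQ, eR]; exact ⟨hP, hR, hQ⟩
  · intro t ht
    obtain ⟨s, hs, rfl⟩ := mem_map_swap12 ht
    obtain ⟨ha, hb, hc⟩ := h11 s hs
    rw [eP, eQ, eR]
    exact ⟨by simpa [add_comm] using hb, by simpa using ha, by simpa [add_comm] using hc⟩
  · intro t ht
    obtain ⟨s, hs, rfl⟩ := mem_map_swap12 ht
    obtain ⟨⟨hab, habt⟩, ⟨hbc, hbct⟩, ⟨hca, hcat⟩⟩ := h14 s hs
    have ev : vol (s.2.1, s.1, s.2.2) = vol s := by simp only [vol]; ring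
    have eu : uu (s.2.1, s.1, s.2.2) = uu s := by simp only [uu]; ring
    have ev' : vv (s.2.1, s.1, s.2.2) = ww s := by simp only [vv, ww]; ring
    have ew : ww (s.2.1, s.1, s.2.2) = vv s := by simp only [vv, ww]; ring
    rw [eP, eQ, eR, ev, eu, ev', ew]
    exact ⟨⟨hab, habt⟩, ⟨hca, hcat⟩, ⟨hbc, hbct⟩⟩

/-- `AdmM` is invariant under transposing the last two coordinates of every member. -/
theorem adm_swap23 (hA : AdmM M F) : AdmM M (F.map fun t => (t.1, t.2.2, t.2.1)) := by
  obtain ⟨eP, eQ, eR, -⟩ := sums_swap23 (F := F)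
  obtain ⟨htab, ⟨hP, hQ, hR⟩, h11, h14⟩ := hA
  refine ⟨?_, ?_, ?_, ?_⟩
  · intro t ht
    obtain ⟨s, hs, rfl⟩ := mem_map_swap23 ht
    obtain ⟨h1, h2, h3, h4⟩ := htab s hs
    refine ⟨h1, h3, h2, ?_⟩
    rw [tableOK_iff' h1 h2 h3] at h4
    rw [tableOK_iff' h1 h3 h2]
    have c1 : s.1 * s.2.2 * s.2.1 = s.1 * s.2.1 * s.2.2 := by ring
    have c2 : s.1 * s.2.2 = s.2.2 * s.1 := by ring
    have c3 : s.2.2 * s.2.1 = s.2.1 * s.2.2 := by ring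
    have c4 : s.2.1 * s.1 = s.1 * s.2.1 := by ring
    rw [c1, c2, c3, c4]
    omega
  · rw [eP, eQ, eR]; exact ⟨hR, hQ, hP⟩
  · intro t ht
    obtain ⟨s, hs, rfl⟩ := mem_map_swap23 ht
    obtain ⟨ha, hb, hc⟩ := h11 s hs
    rw [eP, eQ, eR]
    exact ⟨by simpa [add_comm] using ha, by simpa [add_comm] using hc, by simpa [add_comm] using hb⟩
  · intro t ht
    obtain ⟨s, hs, rfl⟩ := mem_map_swap23 ht
    obtain ⟨⟨hab, habt⟩, ⟨hbc, hbct⟩, ⟨hca, hcat⟩⟩ := h14 s hs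
    have ev : vol (s.1, s.2.2, s.2.1) = vol s := by simp only [vol]; ring
    have eu : uu (s.1, s.2.2, s.2.1) = ww s := by simp only [uu, ww]; ring
    have ev' : vv (s.1, s.2.2, s.2.1) = vv s := by simp only [vv]; ring
    have ew : ww (s.1, s.2.2, s.2.1) = uu s := by simp only [uu, ww]; ring
    rw [eP, eQ, eR, ev, eu, ev', ew]
    exact ⟨⟨hca, hcat⟩, ⟨hbc, hbct⟩, ⟨hab, habt⟩⟩

/-- The residual lists are closed under the transposition of the first two coordinates. -/
theorem residLists_closed12 (M : ℕ) : ∀ L ∈ residLists M, ∃ L' ∈ residLists M,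
    ((L.map fun t => (t.2.1, t.1, t.2.2)) : Multiset (ℕ × ℕ × ℕ)) = (L' : Multiset (ℕ × ℕ × ℕ)) := by
  intro L hL
  unfold residLists at hL ⊢
  split_ifs at hL ⊢ <;> simp only [List.mem_cons, List.not_mem_nil, or_false] at hL <;>
    rcases hL with rfl | rfl | rfl | rfl <;> decide

/-- The residual lists are closed under the transposition of the last two coordinates. -/
theorem residLists_closed23 (M : ℕ) : ∀ L ∈ residLists M, ∃ L' ∈ residLists M,
    ((L.map fun t => (t.1, t.2.2, t.2.1)) : Multiset (ℕ × ℕ × ℕ)) = (L' : Multiset (ℕ × ℕ × ℕ)) := by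
  intro L hL
  unfold residLists at hL ⊢
  split_ifs at hL ⊢ <;> simp only [List.mem_cons, List.not_mem_nil, or_false] at hL <;>
    rcases hL with rfl | rfl | rfl | rfl <;> decide

/-- Residuals of the transposed family (first two coordinates) transfer back. -/
theorem residual_swap12 (h : ResidualM M (F.map fun t => (t.2.1, t.1, t.2.2))) : ResidualM M F := by
  obtain ⟨L, hL, hle⟩ := h
  obtain ⟨L', hL', heq⟩ := residLists_closed12 M L hL
  refine ⟨L', hL', ?_⟩
  rw [← heq, ← Multiset.map_coe]
  have := Multiset.map_le_map (f := fun t : ℕ × ℕ × ℕ => (t.2.1, t.1, t.2.2)) hle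
  simpa [Multiset.map_map, Function.comp_def] using this

/-- Residuals of the transposed family (last two coordinates) transfer back. -/
theorem residual_swap23 (h : ResidualM M (F.map fun t => (t.1, t.2.2, t.2.1))) : ResidualM M F := by
  obtain ⟨L, hL, hle⟩ := h
  obtain ⟨L', hL', heq⟩ := residLists_closed23 M L hL
  refine ⟨L', hL', ?_⟩
  rw [← heq, ← Multiset.map_coe]
  have := Multiset.map_le_map (f := fun t : ℕ × ℕ × ℕ => (t.1, t.2.2, t.2.1)) hle
  simpa [Multiset.map_map, Function.comp_def] using this

end Symmetry

/-! ## From the chunks to all families: sorting the maximal member -/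

section Wlog

variable {M : ℕ}

/-- Stage C: the maximal member's third size is its smallest. -/
theorem residual_stageC (hM : M ≤ 127) (hcov : Covered M) {F : Multiset (ℕ × ℕ × ℕ)} (hA : AdmM M F)
    (hbeat : K * M < sumVal F) {s : ℕ × ℕ × ℕ} (hs : s ∈ F) (hmax : ∀ t ∈ F, vol t ≤ vol s)
    (h3 : s.2.2 ≤ s.1 ∧ s.2.2 ≤ s.2.1) : ResidualM M F := by
  -- the sorted case
  have sorted : ∀ {F : Multiset (ℕ × ℕ × ℕ)}, AdmM M F → K * M < sumVal F → ∀ {s : ℕ × ℕ × ℕ}, s ∈ F →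
      (∀ t ∈ F, vol t ≤ vol s) → s.2.1 ≤ s.1 ∧ s.2.2 ≤ s.2.1 → ResidualM M F := by
    intro F hA hbeat s hs hmax hsort
    obtain ⟨h1, h2, h3, ht4⟩ := hA.1 s hs
    have hV : vol s ≤ M := ((tableOK_iff _ _ _ _).mp ht4).1
    obtain ⟨lo, hi, n, hlo, hhi, hn, hrun⟩ := hcov (vol s) (vol_pos h1 h2 h3) hV
    exact teRun_sound hn hM hrun hA hbeat hs hmax hsort hlo hhi
  rcases Nat.lt_or_ge s.1 s.2.1 with hlt | hge
  · -- swap the first two coordinates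
    apply residual_swap12
    refine sorted (adm_swap12 hA) (by rw [(sums_swap12 (F := F)).2.2.2]; exact hbeat)
      (s := (s.2.1, s.1, s.2.2)) (Multiset.mem_map_of_mem _ hs) ?_ ⟨by simp; omega, by simpa using h3.1⟩
    intro t ht
    obtain ⟨t', ht', rfl⟩ := mem_map_swap12 ht
    have := hmax t' ht'
    simp only [vol] at this ⊢
    nlinarith [this]
  · exact sorted hA hbeat hs hmax ⟨hge, h3.2⟩

/-- Stage B: the maximal member's first size is at least its second. -/
theorem residual_stageB (hM : M ≤ 127) (hcov : Covered M) {F : Multiset (ℕ × ℕ × ℕ)} (hA : AdmM M F)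
    (hbeat : K * M < sumVal F) {s : ℕ × ℕ × ℕ} (hs : s ∈ F) (hmax : ∀ t ∈ F, vol t ≤ vol s)
    (h2 : s.2.1 ≤ s.1) : ResidualM M F := by
  rcases Nat.lt_or_ge s.2.1 s.2.2 with hlt | hge
  · apply residual_swap23
    refine residual_stageC hM hcov (adm_swap23 hA) (by rw [(sums_swap23 (F := F)).2.2.2]; exact hbeat)
      (s := (s.1, s.2.2, s.2.1)) (Multiset.mem_map_of_mem _ hs) ?_ ⟨by simpa using h2, by simp; omega⟩
    intro t ht
    obtain ⟨t', ht', rfl⟩ := mem_map_swap23 ht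
    have := hmax t' ht'
    simp only [vol] at this ⊢
    nlinarith [this]
  · exact residual_stageC hM hcov hA hbeat hs hmax ⟨by omega, hge⟩

/-- **All families.** Every family satisfying `AdmM M` at a covered order `M ≤ 127` whose value sum exceeds `K · M`
contains a registered residual. -/
theorem residual_of_adm (hM : M ≤ 127) (hcov : Covered M) {F : Multiset (ℕ × ℕ × ℕ)} (hA : AdmM M F)
    (hbeat : K * M < sumVal F) : ResidualM M F := by
  -- a member of maximal volume
  have hne : F.toFinset.Nonempty := by
    rw [Multiset.toFinset_nonempty]
    intro h0
    rw [h0] at hbeat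
    simp [sumVal] at hbeat
  obtain ⟨s, hs, hmax⟩ := Finset.exists_max_image F.toFinset vol hne
  rw [Multiset.mem_toFinset] at hs
  replace hmax : ∀ t ∈ F, vol t ≤ vol s := fun t ht => hmax t (Multiset.mem_toFinset.mpr ht)
  rcases Nat.lt_or_ge s.1 s.2.1 with hlt | hge
  · apply residual_swap12
    refine residual_stageB hM hcov (adm_swap12 hA) (by rw [(sums_swap12 (F := F)).2.2.2]; exact hbeat)
      (s := (s.2.1, s.1, s.2.2)) (Multiset.mem_map_of_mem _ hs) ?_ (by simp; omega)
    intro t ht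
    obtain ⟨t', ht', rfl⟩ := mem_map_swap12 ht
    have := hmax t' ht'
    simp only [vol] at this ⊢
    nlinarith [this]
  · exact residual_stageB hM hcov hA hbeat hs hmax hge

end Wlog

end Summit.MatrixMultiplication.MatrixMultiplication.Theorems.TECert
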